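import Summits.Langlands.Langlands.Theorems.PicardMuOrdinaryMuOrdinaryFamilyRTThorneTwistData
import Literature.NumberTheory.Automorphic.Thorne2017AutomorphyLifting
import Literature.NumberTheory.GaloisRepresentations.FramedRepTwist
import HarnessLib

/-!
# Crux `MuOrdinaryFamilyRT` (stmt-Langlands-13757), line `thorne-minimal-lift`: the THREE-WAY CUT of the lead's stub
# `stub_pointAutomorphicTw` — the hypotheses of Thorne's theorem split into a Galois part and an automorphic part, and the two
# AUTOMORPHIC debts (Defs file no. 7 of the line; blueprint `Lines/thorne-minimal-lift-pointAutomorphic.md` § 6)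

The landed Literature fact `Thorne2017.automorphyLifting_unitary_ordinaryMinimal 𝓐` (Thorne, Math. Z. 285 (2017) Thm 5.1, minimal crystalline-ordinary
case; p148560) takes, for a CM field `L`, `ρ : Γ_L → GL₃(ℚ̄₃)`, a residual representation `τ`, a lift `c ∈ Γ_{L⁺}` of complex conjugation and a companion
pair `(π, r)`, the hypotheses (i)–(iv).  This file separates them into

* `GaloisThorneData 𝓐 L ρ r τ c` — everything that concerns `ρ`, `r`, `τ`, `c` only ((i) trace polarization `ρ^c ≅ ρ^∨ ε^{-2}` along `c`; `τ` is a residual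
  representation of `ρ` AND of `r`; Thorne-adequacy of `τ(Γ_{L(ζ₃)})`; `ρ` unramified almost everywhere; `ρ`, `r` unramified at every `v ∤ 3`; at `v ∣ 3` both crystalline
  for the pinned datum and ordinary of one and the same labelled weight for `𝓐 L v`) — the part the Galois side of the line delivers (PA-I, glue over the soluble CM extension of
  CHT Lemma 4.1.2, blueprint § 6);
* `AutThorneData L hcpt ι π r` — what concerns `π`: regular algebraic, conjugate self-dual (`IsEssConjSelfDual 1`), `r` has the characterising property of `r_ι(π)`
  (`HarrisLanTaylorThorne2016.IsCompatible`), and `π` is unramified at every `v ∤ 3` where `r` is;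
* `thorne_apply` — the fact applied to the two (kernel-checked);

and TYPES the two automorphic debts of the stub (honest sub-stubs of the line, each a short chain of printed theorems over the tree's vocabulary, to be promoted):

* PA-C `Missing.thorneCompanionOverL` — from the Thorne-ready companion `r^c` over `F'` (`Qian2022.IsAutomorphic ι r^c`, polarized with exponent `m`), the twist datum `θ`
  and a soluble CM Galois extension `L/F'` over which `(r^c ⊗ θ)|L` is irreducible: a cuspidal `π_L` on `GL₃(𝔸_L)` with `AutThorneData L hcpt ι π_L ((r^c ⊗ θ)|L)`.
  [ACC+ Prop 6.5.13 (1) soluble base change (tree fact `ACC2023.solubleBaseChange_isAutomorphic`); twisting regular algebraic cuspidal automorphy by an algebraic character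
  (CHT Lemma 4.1.3 / BLGGT § 2.1); conjugate self-duality of `π_L` from the polarization of its Galois representation (Jacquet–Shalika strong multiplicity one); Caraiani 2012
  Thm 1.1 unramified compatibility (tree fact `Caraiani2012.unramified_compatibility_racsdc`, p166206).]
* PA-O `Missing.classicalOfAutomorphicTwist` — from the automorphy of `(ρ₀ ⊗ θ)|L` (`ρ₀ = ρ_y|Γ_{F'}`), `L/F'` soluble CM Galois with `(ρ₀ ⊗ θ)|L` irreducible, the `ε^{-2}`-
  polarization of `ρ₀ ⊗ θ`, its unramifiedness off `S' ∪ 3` and the twist datum: a regular algebraic cuspidal `P'` on `GL₃(𝔸_{F'})`, unramified with integrally normalised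
  Satake parameters at every `w ∉ S'` and compatible with `ρ₀` there.  [ACC+ Prop 6.5.13 (2) soluble descent (tree fact `ACC2023.solubleDescent_isAutomorphic`); untwisting by
  `θ⁻¹` (twists of regular algebraic cuspidal representations, Satake parameters of a twist); strong multiplicity one; Caraiani 2012 (tree); integrality of `N w ·` Satake
  parameters of regular algebraic cuspidal representations (Clozel 1990 Thm 3.13 + integral structure on cuspidal cohomology).]

Nothing is asserted (definitions + `thorne_apply` + a projection handle).
-/

set_option linter.dupNamespace false

namespace Summit.Langlands.Langlands.Cruxes.MuOrdinaryFamilyRT.ThorneMinimalLift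

open scoped NumberField Polynomial Matrix Classical
open Field IsDedekindDomain Polynomial Filter
open Literature.NumberTheory.GaloisRepresentations Literature.NumberTheory.Automorphic Literature.NumberTheory.PAdicHodge
open Summit.Langlands.Langlands.Cruxes.MuOrdinaryFamilyRT.CharZeroDominance

noncomputable section

/-! ## 1. The hypotheses of Thorne's theorem, split -/

/-- **`GaloisThorneData 𝓐 L ρ r τ c` — the Galois half of the hypotheses of Thorne 2017 Thm 5.1 (tree fact, `n = p = 3`)**: `c ∈ Γ_{L⁺}` induces complex
conjugation on the CM field `L`; (i) `tr ρ(θ_c σ) = ε(σ)^{-2} tr ρ(σ⁻¹)`; (ii) `τ` is a residual representation of `ρ` with `τ(Γ_{L(ζ₃)})` adequate in Thorne's sense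
(Def 2.20); (iii) `ρ` is unramified almost everywhere; (iv)(a) `τ` is also a residual representation of `r`; (iv)(b) at every `v ∤ 3` both `ρ` and `r` are unramified, and
at every `v ∣ 3` both are crystalline (pinned datum `fontainePstAdicCompletion`) and ordinary of one and the same labelled weight (relative to `𝓐 L v`). -/
def GaloisThorneData
    (𝓐 : ∀ (K : Type) [Field K] [NumberField K] (v : HeightOneSpectrum (𝓞 K)), LocalArtinData (v.adicCompletion K))
    (L : Type) [Field L] [NumberField L] [NumberField.IsCMField L]
    (ρ r : FramedGaloisRep L (PadicAlgCl 3) 3)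
    (τ : absoluteGaloisGroup L →* GL (Fin 3) (padicAlgClResidueField 3))
    (c : absoluteGaloisGroup (NumberField.maximalRealSubfield L)) : Prop :=
  absGaloisQuot (NumberField.maximalRealSubfield L) L c = NumberField.IsCMField.complexConj L ∧
  (∀ σ : absoluteGaloisGroup L,
    ((FramedGaloisRep.outerConj c ρ) σ).val.trace =
      ((Units.map (algebraMap ℤ_[3] (PadicAlgCl 3)).toMonoidHom
          (GaloisRep.cyclotomicCharacter L 3 σ) ^ (1 - (3 : ℤ)) : (PadicAlgCl 3)ˣ) : PadicAlgCl 3) *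
        (ρ σ⁻¹).val.trace) ∧
  ρ.IsResidualRepOf (RingHom.id _) τ ∧
  Subgroup.IsThorne2017Adequate ((absGaloisGroupAdjoinRootsOfUnity L 3).map τ) ∧
  (∀ᶠ v : HeightOneSpectrum (𝓞 L) in cofinite, ρ.IsUnramifiedAt v) ∧
  r.IsResidualRepOf (RingHom.id _) τ ∧
  (∀ v : HeightOneSpectrum (𝓞 L), ((3 : ℕ) : 𝓞 L) ∉ v.asIdeal → ρ.IsUnramifiedAt v ∧ r.IsUnramifiedAt v) ∧
  (∀ (v : HeightOneSpectrum (𝓞 L)) (hv : ((3 : ℕ) : 𝓞 L) ∈ v.asIdeal),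
    (fontainePstAdicCompletion v 3 hv).IsCrystallineFramed (ρ.toLocal v) ∧
    (fontainePstAdicCompletion v 3 hv).IsCrystallineFramed (r.toLocal v) ∧
    ∃ wt : LabelledWeight (v.adicCompletion L) (PadicAlgCl 3) 3,
      ρ.IsOrdinaryOfLabelledWeightAt v (𝓐 L v) wt ∧ r.IsOrdinaryOfLabelledWeightAt v (𝓐 L v) wt)

/-- **`AutThorneData L hcpt ι π r` — the automorphic half of hypothesis (iv)**: `π` is regular algebraic and conjugate self-dual (RACSDC), `r` has the
characterising property of `r_ι(π)` (HLTT), and `π` is unramified at every `v ∤ 3` at which `r` is. -/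
def AutThorneData (L : Type) [Field L] [NumberField L] [NumberField.IsCMField L]
    (hcpt : isCompact_glFiniteIntegralLevel 3 L) (ι : PadicAlgCl 3 ≃+* ℂ)
    (π : CuspidalAutomorphicRepData 3 L hcpt) (r : FramedGaloisRep L (PadicAlgCl 3) 3) : Prop :=
  π.1.IsRegularAlgebraic ∧ π.1.IsEssConjSelfDual 1 ∧ HarrisLanTaylorThorne2016.IsCompatible π.1 ι r ∧
  ∀ v : HeightOneSpectrum (𝓞 L), ((3 : ℕ) : 𝓞 L) ∉ v.asIdeal → r.IsUnramifiedAt v → π.1.IsUnramifiedAt v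

/-- **Thorne's theorem applied to the two halves** (kernel-checked instance of the landed fact with `n = p = 3`, `¬(3 = 2 ∧ Even 3)`). -/
theorem thorne_apply
    {𝓐 : ∀ (K : Type) [Field K] [NumberField K] (v : HeightOneSpectrum (𝓞 K)), LocalArtinData (v.adicCompletion K)}
    (hT : Thorne2017.automorphyLifting_unitary_ordinaryMinimal 𝓐)
    {L : Type} [Field L] [NumberField L] [NumberField.IsCMField L]
    (hcpt : isCompact_glFiniteIntegralLevel 3 L) (ι : PadicAlgCl 3 ≃+* ℂ)
    {ρ r : FramedGaloisRep L (PadicAlgCl 3) 3} {τ : absoluteGaloisGroup L →* GL (Fin 3) (padicAlgClResidueField 3)}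
    {c : absoluteGaloisGroup (NumberField.maximalRealSubfield L)} (π : CuspidalAutomorphicRepData 3 L hcpt)
    (hG : GaloisThorneData 𝓐 L ρ r τ c) (hA : AutThorneData L hcpt ι π r) : Qian2022.IsAutomorphic ι ρ := by
  obtain ⟨hc, hi, hρτ, had, hae, hrτ, hunr, hp⟩ := hG
  obtain ⟨hreg, hcsd, hcomp, hπ⟩ := hA
  have h2 : ¬ (3 = 2 ∧ Even 3) := fun h => by omega
  exact hT L 3 (by norm_num) 3 h2 hcpt ι ρ τ π r c hc hi hρτ had hae hreg hcsd hcomp hrτ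
    (fun v hv => ⟨hπ v hv (hunr v hv).2, (hunr v hv).1, (hunr v hv).2⟩) hp

/-! ## 2. The two automorphic debts of the stub -/

/-- **PA-C — `Missing.thorneCompanionOverL`: the Thorne-ready companion, base-changed to the soluble CM extension and twisted, in the format of
hypothesis (iv).**  For a CM number field `F'` Galois over `ℚ`, a level `S'`, an exponent `m`, a twist datum `θ` (`TwistData m F' S' θ`), a framed
`r^c : Γ_{F'} → GL₃(ℚ̄₃)` which is automorphic in Qian's sense and polarized in trace form with exponent `m`, and a finite soluble Galois CM extension `L/F'` over which
`(r^c ⊗ θ)|L` is irreducible: there is a cuspidal `π_L` on `GL₃(𝔸_L)` with `AutThorneData L hcpt_L ι π_L ((r^c ⊗ θ)|L)`.  Intended proof: `IsAutomorphic ι r^c` ⇒ (twist by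
the algebraic `θ`: CHT Lemma 4.1.3, twisting of regular algebraic cuspidal representations) `IsAutomorphic ι (r^c ⊗ θ)` ⇒ (ACC+ Prop 6.5.13 (1), tree fact
`ACC2023.solubleBaseChange_isAutomorphic`) `IsAutomorphic ι ((r^c ⊗ θ)|L)`: a regular algebraic cuspidal `π_L` with Qian's compatibility; `(r^c ⊗ θ)|L` is `ε^{-2}`-polarized
(landed `tracePolarized_twist`, `tracePolarizedHom_restrict_outerConj`), so `π_L^c` and `π_L^∨` have the same Satake parameters at almost all places, hence `π_L` is conjugate
self-dual (Jacquet–Shalika); then Caraiani 2012 Thm 1.1 (tree fact `Caraiani2012.unramified_compatibility_racsdc`) gives compatibility at every `v ∤ 3` (hence HLTT's property) and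
`π_{L,v}` unramified where the Galois representation is.  A sub-stub of the line (automorphic plumbing over typed Literature facts), not itself a literature fact.
[ACC+ 2023 Prop 6.5.13 (1); CHT 2008 Lemma 4.1.3; Jacquet–Shalika 1981 Thm 4.4; Caraiani 2012 Thm 1.1; HLTT 2016 Thm A] -/
def Missing.thorneCompanionOverL : Prop :=
  ∀ (F' : Type) [Field F'] [NumberField F'] [IsGalois ℚ F'] [NumberField.IsCMField F']
    (ι : PadicAlgCl 3 ≃+* ℂ) (S' : Finset (HeightOneSpectrum (𝓞 F'))) (m : ℤ)
    (θ : absoluteGaloisGroup F' →ₜ* (PadicAlgCl 3)ˣ), TwistData m F' S' θ →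
    ∀ (rc : FramedGaloisRep F' (PadicAlgCl 3) 3), Qian2022.IsAutomorphic ι rc → TracePolarized F' m rc →
    ∀ (L : Type) [Field L] [NumberField L] [NumberField.IsCMField L] [Algebra F' L] [IsGalois F' L],
      IsSolvable (L ≃ₐ[F'] L) → (FramedGaloisRep.restrictField L (rc.twist θ)).toGaloisRep.IsIrreducible →
    ∀ (hcptL : isCompact_glFiniteIntegralLevel 3 L),
      ∃ πL : CuspidalAutomorphicRepData 3 L hcptL, AutThorneData L hcptL ι πL (FramedGaloisRep.restrictField L (rc.twist θ))

/-- **PA-O — `Missing.classicalOfAutomorphicTwist`: from the automorphy of the twist over the soluble CM extension to the classicality clauses over `F'`.**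
For `F'` CM Galois over `ℚ`, a level `S'`, an exponent `m`, a twist datum `θ`, a framed `ρ₀ : Γ_{F'} → GL₃(ℚ̄₃)` (intended `ρ_y|Γ_{F'}`) such that `ρ₀ ⊗ θ` is `ε^{-2}`-polarized in
trace form and unramified at every `w ∉ S'` prime to `3`, and a finite soluble Galois CM extension `L/F'` over which `ρ₀ ⊗ θ` stays irreducible and IS AUTOMORPHIC (Qian): there is a
regular algebraic cuspidal `P'` on `GL₃(𝔸_{F'})` which at every `w ∉ S'` has a Satake parameter `α` with `N w · α` algebraic integers and, for `w ∤ 3`, is compatible with `ρ₀` at `w`.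
Intended proof: soluble descent (ACC+ Prop 6.5.13 (2), tree fact `ACC2023.solubleDescent_isAutomorphic`) gives `IsAutomorphic ι (ρ₀ ⊗ θ)` over `F'`, i.e. a regular algebraic
cuspidal `P''` compatible with `ρ₀ ⊗ θ` at the good places; `ρ₀ ⊗ θ` is `ε^{-2}`-polarized so `P''` is conjugate self-dual (Jacquet–Shalika) and Caraiani 2012 (tree fact) makes `P''`
unramified and compatible at EVERY `w ∉ S'`, `w ∤ 3`; `P' := P'' ⊗ (θ⁻¹ ∘ Art)` (twisting by the algebraic Hecke character of `θ⁻¹`, unramified at such `w` by (t4)) has Satake parameters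
those of `P''` multiplied by `θ⁻¹(Frob_w)` and is compatible with `ρ₀ = (ρ₀ ⊗ θ) ⊗ θ⁻¹` (`hasFrobCharpolyAt_twist_of_eq_prod`); integrality of `N w ·` Satake parameters of the regular
algebraic cuspidal `P'` (Clozel).  A sub-stub of the line, not a literature fact.
[ACC+ 2023 Prop 6.5.13 (2); Jacquet–Shalika 1981; Caraiani 2012 Thm 1.1; CHT 2008 Lemma 4.1.3; Clozel 1990 Thm 3.13] -/
def Missing.classicalOfAutomorphicTwist : Prop :=
  ∀ (F' : Type) [Field F'] [NumberField F'] [IsGalois ℚ F'] [NumberField.IsCMField F']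
    (ι : PadicAlgCl 3 ≃+* ℂ) (hcpt' : isCompact_glFiniteIntegralLevel 3 F') (S' : Finset (HeightOneSpectrum (𝓞 F'))) (m : ℤ)
    (θ : absoluteGaloisGroup F' →ₜ* (PadicAlgCl 3)ˣ), TwistData m F' S' θ →
    ∀ (ρ₀ : FramedGaloisRep F' (PadicAlgCl 3) 3),
      TracePolarized F' (-2) (ρ₀.twist θ) →
      (∀ w : HeightOneSpectrum (𝓞 F'), w ∉ S' → ((3 : ℕ) : 𝓞 F') ∉ w.asIdeal → FramedGaloisRep.IsUnramifiedAt w (ρ₀.twist θ)) →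
    ∀ (L : Type) [Field L] [NumberField L] [NumberField.IsCMField L] [Algebra F' L] [IsGalois F' L],
      IsSolvable (L ≃ₐ[F'] L) → (FramedGaloisRep.restrictField L (ρ₀.twist θ)).toGaloisRep.IsIrreducible →
      Qian2022.IsAutomorphic ι (FramedGaloisRep.restrictField L (ρ₀.twist θ)) →
      ∃ P' : CuspidalAutomorphicRepData 3 F' hcpt',
        P'.1.IsRegularAlgebraic ∧
        ∀ w ∉ S', (∃ α : Multiset ℂ, P'.1.HasSatakeParamAt w α ∧
            ∀ a ∈ α, IsIntegral ℤ ((w.residueCard : ℂ) * a)) ∧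
          (((3 : ℕ) : 𝓞 F') ∉ w.asIdeal → IsGaloisCompatibleAt P'.1 ι ρ₀ w)

/-! ## 3. Registered handle -/

/-- `AutThorneData` records in particular the characterising property (projection; the registered handle through which this Defs file lands). -/
theorem isCompatible_of_autThorneData : ∀ (L : Type) [Field L] [NumberField L] [NumberField.IsCMField L] (hcpt : isCompact_glFiniteIntegralLevel 3 L) (ι : PadicAlgCl 3 ≃+* ℂ) (π : CuspidalAutomorphicRepData 3 L hcpt) (r : FramedGaloisRep L (PadicAlgCl 3) 3), AutThorneData L hcpt ι π r → HarrisLanTaylorThorne2016.IsCompatible π.1 ι r :=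
  fun _ _ _ _ _ _ _ _ h => h.2.2.1

end

end Summit.Langlands.Langlands.Cruxes.MuOrdinaryFamilyRT.ThorneMinimalLift
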